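import Literature.NumberTheory.Sieve.QuadraticRootsPrimeModuliDFISieveReindex
import Literature.NumberTheory.Sieve.QuadraticRootsPrimeModuliDFISieveEstimates
import HarnessLib

/-!
# Duke–Friedlander–Iwaniec 1995, §6: integers free of small primes; `S(C, z)` versus `∑_{p ≤ x} c_p`

Topic `Literature/NumberTheory/Sieve`.  Towards the discharge of
`Literature.NumberTheory.Sieve.dukeFriedlanderIwaniec1995_theorem5` (W. Duke, J. B. Friedlander,
H. Iwaniec, Ann. of Math. 141 (1995), §6 p. 437).  The estimates by which Theorem 5 is read off
Lemma 3 rest only on `|c_n| ≤ τ(n)`, Chebyshev's bound and Mertens' second theorem; this file gives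
the tools and the second of them (quotient convention of `…DFISieveReindex`):

* an integer `> 1` coprime to `P(t)` and `< t²` is prime (`DFI1995.prime_of_coprime_primesProdBelow`);
  `−log(1 − t) ≤ 2t` on `[0, 1/2]` and the two logarithmic window evaluations used for the ranges
  `y ≤ q < x^{1/3}`, `q < p ≤ x/q²` (`DFI1995.log_le_twelve_mul`, `DFI1995.log_window_outer_le`);
* `DFI1995.norm_primeSum_sub_sifted_le` — the paper's "if `z = x^{1/2−ε}` then
  `S(C, z) = ∑_{z≤p≤x} c_p + O(∑_{z≤p<x^{1/2}} (x/p)(log(x/p))^{−1}) = ∑_{p≤x} c_p + O(εx/log x)`": for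
  `4 ≤ z ≤ √x`, `x < z³`,
  `|∑_{p ≤ x} c_p − S(C, z)| ≤ 2z + 6 + 40 (x/log x)(log(log √x / log(z/2)) + 16/log(z/2))`
  (the integers `n ≤ x` free of primes `< z` are `1`, the primes `≥ z`, and products `ab` of two
  primes `z ≤ a ≤ √x`, counted by Chebyshev and a Mertens window).

The companion `…DFISieveLeft` bounds the terms `y ≤ q < p < z` of the double Buchstab sum.
Everything here is proved.

## References

* W. Duke, J. B. Friedlander, H. Iwaniec, Ann. of Math. (2) 141 (1995), 423–441, §6 p. 437 (between
  Lemma 3 (36) and Theorem 5 (37)). [cite: DukeFriedlanderIwaniec1995, §6 p. 437]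
-/

namespace Literature.NumberTheory.Sieve

open scoped BigOperators
open Finset Real

namespace DFI1995

noncomputable section

/-! ### Integers free of small primes -/

/-- If `n > 1` is coprime to `P(t)`, its least prime factor is `≥ t`. [folklore] -/
theorem le_minFac_of_coprime_primesProdBelow {n : ℕ} (hn : 1 < n) {t : ℝ}
    (hcop : n.Coprime (primesProdBelow t)) : t ≤ (n.minFac : ℝ) := by
  by_contra hlt
  rw [not_le] at hlt
  rw [coprime_primesProdBelow_iff] at hcop
  have hmem : n.minFac ∈ Nat.primesBelow ⌈t⌉₊ :=
    Nat.mem_primesBelow.2 ⟨Nat.lt_ceil.2 hlt, Nat.minFac_prime hn.ne'⟩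
  exact hcop _ hmem (Nat.minFac_dvd n)

/-- An integer `n > 1` coprime to `P(t)` (`t ≥ 0`) with `n < t²` is prime (a composite `n` has
`minFac(n)² ≤ n`). [folklore] -/
theorem prime_of_coprime_primesProdBelow {n : ℕ} (hn : 1 < n) {t : ℝ} (ht0 : 0 ≤ t)
    (hcop : n.Coprime (primesProdBelow t)) (hlt : (n : ℝ) < t ^ 2) : n.Prime := by
  by_contra hnp
  have ht : t ≤ (n.minFac : ℝ) := le_minFac_of_coprime_primesProdBelow hn hcop
  have hsq : n.minFac ^ 2 ≤ n := Nat.minFac_sq_le_self (by omega) hnp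
  have hsq' : ((n.minFac : ℝ)) ^ 2 ≤ n := by exact_mod_cast hsq
  nlinarith [mul_le_mul ht ht ht0 (Nat.cast_nonneg _)]

/-- `−log(1 − t) ≤ 2t` for `0 ≤ t ≤ 1/2`. [folklore] -/
theorem neg_log_one_sub_le {t : ℝ} (ht0 : 0 ≤ t) (ht : t ≤ 1 / 2) : -Real.log (1 - t) ≤ 2 * t := by
  have h1 : 0 < 1 - t := by linarith
  have h := Real.one_sub_inv_le_log_of_pos h1
  -- `-log(1-t) ≤ 1/(1-t) - 1 = t/(1-t) ≤ 2t`
  have h2 : (1 - t)⁻¹ ≤ 1 + 2 * t := by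
    rw [inv_le_iff_one_le_mul₀ h1]
    nlinarith
  linarith

/-- `log r ≤ 12ε` when `0 < r ≤ (1 + 6ε)/(1 − 3ε)`, `0 < ε ≤ 1/24`. [folklore] -/
theorem log_le_twelve_mul {ε r : ℝ} (hε : 0 < ε) (hε' : ε ≤ 1 / 24) (hr : 0 < r)
    (hle : r ≤ (1 + 6 * ε) / (1 - 3 * ε)) : Real.log r ≤ 12 * ε := by
  have h3 : 0 < 1 - 3 * ε := by linarith
  calc Real.log r ≤ Real.log ((1 + 6 * ε) / (1 - 3 * ε)) := Real.log_le_log hr hle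
    _ = Real.log (1 + 6 * ε) - Real.log (1 - 3 * ε) :=
        Real.log_div (by positivity) h3.ne'
    _ ≤ 6 * ε + 2 * (3 * ε) := by
        have h1 : Real.log (1 + 6 * ε) ≤ 6 * ε := by
          have := Real.log_le_sub_one_of_pos (show 0 < 1 + 6 * ε by linarith); linarith
        have h2 : -Real.log (1 - 3 * ε) ≤ 2 * (3 * ε) := neg_log_one_sub_le (by linarith) (by linarith)
        linarith
    _ = 12 * ε := by ring

/-- The outer Mertens window in the proof of `DFI1995.norm_doubleSum_left_le`: with `L = log x ≥ 16`,
`ℓ = log y = (1/3 − ε)L`, `0 < ε ≤ 1/24`,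
`log((L/3)/(ℓ − log 2)) + 16/(ℓ − log 2) ≤ 6ε + 133/L`. [folklore] -/
theorem log_window_outer_le {ε L ℓ : ℝ} (hε : 0 < ε) (hε' : ε ≤ 1 / 24) (hL : 16 ≤ L)
    (hℓ : ℓ = (1 / 3 - ε) * L) :
    Real.log ((L / 3) / (ℓ - Real.log 2)) + 16 / (ℓ - Real.log 2) ≤ 6 * ε + 133 / L := by
  have hL0 : 0 < L := by linarith
  have hlog2 : Real.log 2 < 0.6931471808 := Real.log_two_lt_d9
  have hlog2' : 0 < Real.log 2 := Real.log_pos one_lt_two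
  have hden : L / 8 ≤ ℓ - Real.log 2 := by rw [hℓ]; nlinarith
  have hden0 : 0 < ℓ - Real.log 2 := by linarith
  -- ratio `= 1/(1 - t)`, `t = 3ε + 3 log 2/L ≤ 1/2`
  set t : ℝ := 3 * ε + 3 * Real.log 2 / L with ht
  have ht0 : 0 ≤ t := by positivity
  have h3L : 3 * Real.log 2 / L ≤ 3 * Real.log 2 / 16 :=
    div_le_div_of_nonneg_left (by positivity) (by norm_num) hL
  have ht1 : t ≤ 1 / 2 := by rw [ht]; nlinarith
  have hratio : (L / 3) / (ℓ - Real.log 2) = 1 / (1 - t) := by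
    rw [hℓ, ht]
    field_simp
    ring
  have h1 : Real.log ((L / 3) / (ℓ - Real.log 2)) ≤ 2 * t := by
    rw [hratio, one_div, Real.log_inv]
    exact neg_log_one_sub_le ht0 ht1
  have h2 : 16 / (ℓ - Real.log 2) ≤ 128 / L := by
    rw [div_le_div_iff₀ hden0 hL0]; linarith
  have h3 : 2 * t ≤ 6 * ε + 5 / L := by
    rw [ht]
    have : 6 * Real.log 2 / L ≤ 5 / L := div_le_div_of_nonneg_right (by nlinarith) hL0.le
    have e : 2 * (3 * ε + 3 * Real.log 2 / L) = 6 * ε + 6 * Real.log 2 / L := by ring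
    linarith
  have h4 : 5 / L + 128 / L = 133 / L := by rw [← add_div]; norm_num
  linarith

/-- `2 log 4 + 2 ≤ 5` (the constant of `DFI1995.primeCounting_le_mul_div_log`). [folklore] -/
theorem two_mul_log_four_add_two_le : 2 * Real.log 4 + 2 ≤ 5 := by
  have hlog2 : Real.log 2 < 0.6931471808 := Real.log_two_lt_d9
  have h4 : Real.log 4 = 2 * Real.log 2 := by
    rw [show (4 : ℝ) = 2 ^ 2 by norm_num, Real.log_pow]; norm_num
  rw [h4]; linarith

/-- `#(primesIco u v) ≤ v + 1` for `v ≥ 0`. [folklore] -/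
theorem card_primesIco_le {u v : ℝ} (hv : 0 ≤ v) : ((primesIco u v).card : ℝ) ≤ v + 1 := by
  have h1 : (primesIco u v).card ≤ ⌈v⌉₊ := by
    unfold primesIco Nat.primesBelow
    exact (Finset.card_filter_le _ _).trans ((Finset.card_filter_le _ _).trans (by simp))
  calc ((primesIco u v).card : ℝ) ≤ ⌈v⌉₊ := by exact_mod_cast h1
    _ ≤ v + 1 := (Nat.ceil_lt_add_one hv).le

/-! ### `S(C, z)` versus `∑_{p ≤ x} c_p` -/

/-- **`S(C, z)` versus `∑_{p ≤ x} c_p`** (p. 437): for `|c_n| ≤ τ(n)`, `4 ≤ z ≤ √x` and `x < z³`,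
`|∑_{p ≤ x} c_p − S(C, z)| ≤ 2z + 6 + 40 (x/log x)(log(log √x/log(z/2)) + 16/log(z/2))`: the `n ≤ x`
coprime to `P(z)` are `1`, the primes `z ≤ p ≤ x` and the products `ab` of two primes with
`z ≤ a ≤ √x` (`b = n/a` is prime as `b < x/z < z²`), at most `∑_{z ≤ a ≤ √x} π(x/a)` of them, while
the primes `p < z` contribute at most `2(z+1)`. [cite: DukeFriedlanderIwaniec1995, §6 p. 437] -/
theorem norm_primeSum_sub_sifted_le {c : ℕ → ℂ} (hc : ∀ n : ℕ, 1 ≤ n → ‖c n‖ ≤ (Nat.divisors n).card)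
    {x z : ℝ} (hz4 : 4 ≤ z) (hzx : z ≤ Real.sqrt x) (hxz : x < z ^ 3) :
    ‖∑ p ∈ Nat.primesLE ⌊x⌋₊, c p - siftedQ c x 1 z‖ ≤
      2 * z + 6 + 40 * (x / Real.log x) *
        (Real.log (Real.log (Real.sqrt x) / Real.log (z / 2)) + 16 / Real.log (z / 2)) := by
  classical
  have hz0 : 0 < z := by linarith
  have hx16 : 16 ≤ x := by
    have h1 : z ^ 2 ≤ Real.sqrt x ^ 2 := pow_le_pow_left₀ hz0.le hzx 2
    have hx0 : 0 ≤ x := by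
      by_contra h
      rw [not_le] at h
      rw [Real.sqrt_eq_zero'.2 h.le] at hzx
      linarith
    rw [Real.sq_sqrt hx0] at h1
    nlinarith
  have hx0 : 0 < x := by linarith
  have hx1 : 1 ≤ x := by linarith
  set L := Real.log x with hLdef
  have hL0 : 0 < L := Real.log_pos (by linarith)
  have hsqrt2 : (2 : ℝ) ≤ Real.sqrt x := by linarith
  have hlogsqrt : Real.log (Real.sqrt x) = L / 2 := by rw [Real.log_sqrt hx0.le]
  set Wz : ℝ := Real.log (Real.log (Real.sqrt x) / Real.log (z / 2)) + 16 / Real.log (z / 2) with hWz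
  set R := (Icc 1 ⌊x⌋₊).filter (fun n : ℕ => n.Coprime (primesProdBelow z)) with hR
  -- `S(C, z) = ∑_{n ∈ R} c_n`
  have hS : siftedQ c x 1 z = ∑ n ∈ R, c n := by
    rw [siftedQ_eq_sum_filter, Nat.div_one]
    refine Finset.sum_congr rfl fun n _ => by rw [one_mul]
  -- the primes of `R` are the primes `z ≤ p ≤ x`
  have hRprime : R.filter (fun n : ℕ => n.Prime) = (Nat.primesLE ⌊x⌋₊).filter (fun p : ℕ => z ≤ (p : ℝ)) := by
    ext n
    simp only [hR, Finset.mem_filter, Finset.mem_Icc, Nat.mem_primesLE]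
    constructor
    · rintro ⟨⟨⟨-, hnx⟩, hcop⟩, hnp⟩
      refine ⟨⟨hnx, hnp⟩, ?_⟩
      have h := le_minFac_of_coprime_primesProdBelow hnp.one_lt hcop
      rwa [Nat.Prime.minFac_eq hnp] at h
    · rintro ⟨⟨hnx, hnp⟩, hzn⟩
      exact ⟨⟨⟨hnp.one_le, hnx⟩, prime_coprime_primesProdBelow hnp hzn⟩, hnp⟩
  -- decomposition of the difference
  have hdiff : ∑ p ∈ Nat.primesLE ⌊x⌋₊, c p - siftedQ c x 1 z =
      ∑ p ∈ (Nat.primesLE ⌊x⌋₊).filter (fun p : ℕ => ¬ z ≤ (p : ℝ)), c p -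
        ∑ n ∈ R.filter (fun n : ℕ => ¬ n.Prime), c n := by
    rw [hS, ← Finset.sum_filter_add_sum_filter_not (Nat.primesLE ⌊x⌋₊) (fun p : ℕ => z ≤ (p : ℝ)),
      ← Finset.sum_filter_add_sum_filter_not R (fun n : ℕ => n.Prime), hRprime]
    ring
  rw [hdiff]
  -- (1) the primes `< z`
  have h1 : ‖∑ p ∈ (Nat.primesLE ⌊x⌋₊).filter (fun p : ℕ => ¬ z ≤ (p : ℝ)), c p‖ ≤ 2 * (z + 1) := by
    refine (norm_sum_le _ _).trans ?_
    have hterm : ∀ p ∈ (Nat.primesLE ⌊x⌋₊).filter (fun p : ℕ => ¬ z ≤ (p : ℝ)), ‖c p‖ ≤ 2 := by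
      intro p hp
      simp only [Finset.mem_filter, Nat.mem_primesLE] at hp
      have hpp := hp.1.2
      calc ‖c p‖ ≤ (p.divisors.card : ℝ) := hc p hpp.one_le
        _ = 2 := by rw [Nat.Prime.divisors hpp, Finset.card_pair hpp.ne_one.symm]; norm_num
    have hcard : (((Nat.primesLE ⌊x⌋₊).filter (fun p : ℕ => ¬ z ≤ (p : ℝ))).card : ℝ) ≤ z + 1 := by
      have hsub : ((Nat.primesLE ⌊x⌋₊).filter (fun p : ℕ => ¬ z ≤ (p : ℝ))).card ≤ (Finset.range ⌈z⌉₊).card := by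
        refine Finset.card_le_card_of_injOn id (fun p hp => ?_) (Set.injOn_id _)
        rw [Finset.mem_coe, Finset.mem_filter, not_le] at hp
        rw [Finset.mem_coe, Finset.mem_range]
        exact Nat.lt_ceil.2 hp.2
      rw [Finset.card_range] at hsub
      calc (((Nat.primesLE ⌊x⌋₊).filter (fun p : ℕ => ¬ z ≤ (p : ℝ))).card : ℝ) ≤ ⌈z⌉₊ := by
            exact_mod_cast hsub
        _ ≤ z + 1 := (Nat.ceil_lt_add_one hz0.le).le
    calc ∑ p ∈ (Nat.primesLE ⌊x⌋₊).filter (fun p : ℕ => ¬ z ≤ (p : ℝ)), ‖c p‖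
        ≤ ∑ p ∈ (Nat.primesLE ⌊x⌋₊).filter (fun p : ℕ => ¬ z ≤ (p : ℝ)), (2 : ℝ) := Finset.sum_le_sum hterm
      _ = 2 * (((Nat.primesLE ⌊x⌋₊).filter (fun p : ℕ => ¬ z ≤ (p : ℝ))).card : ℝ) := by
          rw [Finset.sum_const, nsmul_eq_mul, mul_comm]
      _ ≤ 2 * (z + 1) := by linarith
  -- structure of the non-primes of `R`: `1` or `a b` with `a = minFac`, `b` prime
  have hstruct : ∀ n ∈ (R.filter (fun n : ℕ => ¬ n.Prime)).filter (fun n : ℕ => n ≠ 1),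
      n.minFac.Prime ∧ z ≤ (n.minFac : ℝ) ∧ (n.minFac : ℝ) ≤ Real.sqrt x ∧ (n / n.minFac).Prime ∧
        n / n.minFac ≤ ⌊x⌋₊ / n.minFac ∧ n.minFac * (n / n.minFac) = n := by
    intro n hn
    simp only [hR, Finset.mem_filter, Finset.mem_Icc] at hn
    obtain ⟨⟨⟨⟨hn1, hnx⟩, hcop⟩, hnp⟩, hn1'⟩ := hn
    have hn_gt : 1 < n := lt_of_le_of_ne hn1 (Ne.symm hn1')
    set a := n.minFac with ha
    have haprime : a.Prime := Nat.minFac_prime hn_gt.ne'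
    have hza : z ≤ (a : ℝ) := le_minFac_of_coprime_primesProdBelow hn_gt hcop
    have ha0 : (0 : ℝ) < a := by linarith
    have hmul : a * (n / a) = n := Nat.mul_div_cancel' (Nat.minFac_dvd n)
    have hnx' : (n : ℝ) ≤ x := le_trans (by exact_mod_cast hnx) (Nat.floor_le hx0.le)
    have hasq : a ^ 2 ≤ n := Nat.minFac_sq_le_self (by omega) hnp
    have hasqrt : (a : ℝ) ≤ Real.sqrt x := by
      rw [Real.le_sqrt ha0.le hx0.le]  -- `a ≤ √x ↔ a² ≤ x`
      calc (a : ℝ) ^ 2 = ((a ^ 2 : ℕ) : ℝ) := by push_cast; ring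
        _ ≤ n := by exact_mod_cast hasq
        _ ≤ x := hnx'
    set b := n / a with hb
    have hb_gt : 1 < b := by
      by_contra h
      rw [not_lt] at h
      interval_cases b
      · simp at hmul; omega
      · rw [mul_one] at hmul
        exact hnp (hmul ▸ haprime)
    have hbcop : b.Coprime (primesProdBelow z) :=
      Nat.Coprime.coprime_dvd_left (Nat.div_dvd_of_dvd (Nat.minFac_dvd n)) hcop
    have hbreal : (b : ℝ) = n / a := by
      rw [eq_div_iff ha0.ne']
      have : ((a * b : ℕ) : ℝ) = n := by rw [hmul]
      push_cast at this
      linarith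
    have hblt : (b : ℝ) < z ^ 2 := by
      rw [hbreal, div_lt_iff₀ ha0]
      calc (n : ℝ) ≤ x := hnx'
        _ < z ^ 3 := hxz
        _ = z ^ 2 * z := by ring
        _ ≤ z ^ 2 * a := mul_le_mul_of_nonneg_left hza (by positivity)
    have hbprime : b.Prime := prime_of_coprime_primesProdBelow hb_gt hz0.le hbcop hblt
    exact ⟨haprime, hza, hasqrt, hbprime, Nat.div_le_div_right hnx, hmul⟩
  -- (2) the non-primes of `R`: each `|c_n| ≤ 4`, and their number is `≤ 1 + #comp`
  set A := (Nat.primesLE ⌊Real.sqrt x⌋₊).filter (fun a : ℕ => z ≤ (a : ℝ)) with hA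
  have h2 : ‖∑ n ∈ R.filter (fun n : ℕ => ¬ n.Prime), c n‖ ≤
      4 + 4 * ∑ a ∈ A, (Nat.primeCounting (⌊x⌋₊ / a) : ℝ) := by
    refine (norm_sum_le _ _).trans ?_
    have hterm : ∀ n ∈ R.filter (fun n : ℕ => ¬ n.Prime), ‖c n‖ ≤ 4 := by
      intro n hn
      by_cases hn1 : n = 1
      · subst hn1
        calc ‖c 1‖ ≤ ((1 : ℕ).divisors.card : ℝ) := hc 1 le_rfl
          _ ≤ 4 := by simp
      · obtain ⟨hap, -, -, hbp, -, hmul⟩ := hstruct n (Finset.mem_filter.2 ⟨hn, hn1⟩)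
        have hn0 : 1 ≤ n := by
          have := (Finset.mem_filter.1 hn).1
          simp only [hR, Finset.mem_filter, Finset.mem_Icc] at this
          exact this.1.1
        calc ‖c n‖ ≤ (n.divisors.card : ℝ) := hc n hn0
          _ ≤ 4 := by
            have h := card_divisors_mul_le n.minFac (n / n.minFac)
            rw [hmul, Nat.Prime.divisors hap, Finset.card_pair hap.ne_one.symm, Nat.Prime.divisors hbp,
              Finset.card_pair hbp.ne_one.symm] at h
            exact_mod_cast h
    have hcount : (((R.filter (fun n : ℕ => ¬ n.Prime))).card : ℝ) ≤
        1 + ∑ a ∈ A, (Nat.primeCounting (⌊x⌋₊ / a) : ℝ) := by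
      set Rnp := R.filter (fun n : ℕ => ¬ n.Prime) with hRnp
      have hsplit := Finset.card_filter_add_card_filter_not (s := Rnp) (fun n : ℕ => n ≠ 1)
      have hone : (Rnp.filter (fun n : ℕ => ¬ n ≠ 1)).card ≤ 1 := by
        refine Finset.card_le_one.2 fun a ha b hb => ?_
        rw [Finset.mem_filter, not_ne_iff] at ha hb
        rw [ha.2, hb.2]
      -- injection `n ↦ (minFac n, n / minFac n)` into `A.sigma (fun a => primesLE (⌊x⌋/a))`
      have hcomp : (Rnp.filter (fun n : ℕ => n ≠ 1)).card ≤
          (A.sigma (fun a : ℕ => Nat.primesLE (⌊x⌋₊ / a))).card := by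
        refine Finset.card_le_card_of_injOn (fun n : ℕ => (⟨n.minFac, n / n.minFac⟩ : Σ _ : ℕ, ℕ))
          (fun n hn => ?_) (fun n hn n' hn' h => ?_)
        · rw [Finset.mem_coe] at hn
          obtain ⟨hap, hza, hasqrt, hbp, hble, -⟩ := hstruct n hn
          rw [Finset.mem_coe, Finset.mem_sigma, hA, Finset.mem_filter, Nat.mem_primesLE, Nat.mem_primesLE]
          exact ⟨⟨⟨Nat.le_floor hasqrt, hap⟩, hza⟩, hble, hbp⟩
        · rw [Finset.mem_coe] at hn hn'
          obtain ⟨-, -, -, -, -, hmul⟩ := hstruct n hn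
          obtain ⟨-, -, -, -, -, hmul'⟩ := hstruct n' hn'
          simp only [Sigma.mk.injEq, heq_eq_eq] at h
          obtain ⟨h1, h2⟩ := h
          calc n = n.minFac * (n / n.minFac) := hmul.symm
            _ = n'.minFac * (n' / n'.minFac) := by rw [h2, h1]
            _ = n' := hmul'
      rw [Finset.card_sigma] at hcomp
      have hc' : Rnp.card ≤ 1 + ∑ a ∈ A, (Nat.primesLE (⌊x⌋₊ / a)).card := by omega
      calc (Rnp.card : ℝ) ≤ ((1 + ∑ a ∈ A, (Nat.primesLE (⌊x⌋₊ / a)).card : ℕ) : ℝ) := by exact_mod_cast hc'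
        _ = 1 + ∑ a ∈ A, (Nat.primeCounting (⌊x⌋₊ / a) : ℝ) := by
            push_cast
            simp only [Nat.primesLE_card_eq_primeCounting]
    calc ∑ n ∈ R.filter (fun n : ℕ => ¬ n.Prime), ‖c n‖ ≤ ∑ n ∈ R.filter (fun n : ℕ => ¬ n.Prime), (4 : ℝ) :=
          Finset.sum_le_sum hterm
      _ = 4 * (((R.filter (fun n : ℕ => ¬ n.Prime))).card : ℝ) := by
          rw [Finset.sum_const, nsmul_eq_mul, mul_comm]
      _ ≤ 4 * (1 + ∑ a ∈ A, (Nat.primeCounting (⌊x⌋₊ / a) : ℝ)) := by gcongr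
      _ = 4 + 4 * ∑ a ∈ A, (Nat.primeCounting (⌊x⌋₊ / a) : ℝ) := by ring
  -- (3) Chebyshev and the Mertens window for `∑_{a ∈ A} π(x/a)`
  have h3 : ∑ a ∈ A, (Nat.primeCounting (⌊x⌋₊ / a) : ℝ) ≤ 10 * (x / L) * Wz := by
    have hmemA : ∀ a ∈ A, a.Prime ∧ z / 2 < (a : ℝ) ∧ (a : ℝ) ≤ Real.sqrt x := by
      intro a ha
      rw [hA, Finset.mem_filter, Nat.mem_primesLE] at ha
      obtain ⟨⟨hale, hap⟩, hza⟩ := ha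
      refine ⟨hap, by linarith, ?_⟩
      exact le_trans (by exact_mod_cast hale) (Nat.floor_le (Real.sqrt_nonneg x))
    have hterm : ∀ a ∈ A, (Nat.primeCounting (⌊x⌋₊ / a) : ℝ) ≤ 10 * (x / L) * (a : ℝ)⁻¹ := by
      intro a ha
      obtain ⟨hap, hza, hasqrt⟩ := hmemA a ha
      have ha0 : (0 : ℝ) < a := by exact_mod_cast hap.pos
      have hza' : z ≤ (a : ℝ) := by
        rw [hA, Finset.mem_filter] at ha; exact ha.2
      -- `x/a ≥ √x ≥ 2`, `log(x/a) ≥ L/2`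
      have hxa : Real.sqrt x ≤ x / a := by
        rw [le_div_iff₀ ha0]
        calc Real.sqrt x * a ≤ Real.sqrt x * Real.sqrt x :=
              mul_le_mul_of_nonneg_left hasqrt (Real.sqrt_nonneg x)
          _ = x := Real.mul_self_sqrt hx0.le
      have hxa2 : (2 : ℝ) ≤ x / a := hsqrt2.trans hxa
      have hlog : L / 2 ≤ Real.log (x / a) := by
        rw [← hlogsqrt]; exact Real.log_le_log (by linarith) hxa
      have hch := primeCounting_le_mul_div_log hxa2
      rw [Nat.floor_div_natCast] at hch
      calc (Nat.primeCounting (⌊x⌋₊ / a) : ℝ) ≤ (2 * Real.log 4 + 2) * (x / a) / Real.log (x / a) := hch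
        _ ≤ 5 * (x / a) / (L / 2) := by
            have hxa0 : 0 ≤ x / a := by positivity
            calc (2 * Real.log 4 + 2) * (x / a) / Real.log (x / a) ≤ 5 * (x / a) / Real.log (x / a) := by
                  gcongr
                  · linarith
                  · exact two_mul_log_four_add_two_le
              _ ≤ 5 * (x / a) / (L / 2) := div_le_div_of_nonneg_left (by positivity) (by positivity) hlog
        _ = 10 * (x / L) * (a : ℝ)⁻¹ := by field_simp; norm_num
    have hwin : ∑ a ∈ A, (a : ℝ)⁻¹ ≤ Wz := by
      have h := sum_inv_primes_window_le (by linarith : (2 : ℝ) ≤ z / 2) (by linarith : z / 2 ≤ Real.sqrt x) hmemA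
      rw [hWz]; exact h
    calc ∑ a ∈ A, (Nat.primeCounting (⌊x⌋₊ / a) : ℝ) ≤ ∑ a ∈ A, 10 * (x / L) * (a : ℝ)⁻¹ := Finset.sum_le_sum hterm
      _ = 10 * (x / L) * ∑ a ∈ A, (a : ℝ)⁻¹ := by rw [Finset.mul_sum]
      _ ≤ 10 * (x / L) * Wz := mul_le_mul_of_nonneg_left hwin (by positivity)
  -- assemble
  calc ‖∑ p ∈ (Nat.primesLE ⌊x⌋₊).filter (fun p : ℕ => ¬ z ≤ (p : ℝ)), c p -
        ∑ n ∈ R.filter (fun n : ℕ => ¬ n.Prime), c n‖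
      ≤ ‖∑ p ∈ (Nat.primesLE ⌊x⌋₊).filter (fun p : ℕ => ¬ z ≤ (p : ℝ)), c p‖ +
        ‖∑ n ∈ R.filter (fun n : ℕ => ¬ n.Prime), c n‖ := norm_sub_le _ _
    _ ≤ 2 * (z + 1) + (4 + 4 * (10 * (x / L) * Wz)) := by
        have := mul_le_mul_of_nonneg_left h3 (by norm_num : (0 : ℝ) ≤ 4)
        linarith
    _ = 2 * z + 6 + 40 * (x / L) * Wz := by ring

end

end DFI1995

end Literature.NumberTheory.Sieve
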